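import Literature.NumberTheory.EllipticCurves.PastenValuationProduct
import Literature.NumberTheory.DiophantineGeometry.ValuationProductElliptic
import Literature.NumberTheory.DiophantineGeometry.PastenValuationProducts
import Literature.NumberTheory.DiophantineGeometry.ConductorMultiplicativeProofs
import Literature.NumberTheory.DiophantineGeometry.ConductorExponentZeroProofs
import Literature.NumberTheory.DiophantineGeometry.ConductorFactorizationProofs
import Literature.NumberTheory.DiophantineGeometry.MinimalDiscriminantFactorizationProofs
import HarnessLib

/-!
# Pasten, Corollary 16.2: the geometric rendering follows from the conductor-exponent rendering

Topic `NumberTheory/EllipticCurves`; namespace `Literature.NumberTheory.EllipticCurves`.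

H. Pasten, *Shimura curves and the abc conjecture*, J. Number Theory 254 (2024) 214–335
(= arXiv:1705.09251, held; arXiv numbering), **Corollary 16.2** (p. 49 of the arXiv text):
"Let `S` be a finite set of primes and let `ε > 0`. For all but finitely many elliptic curves
`E/ℚ` semi-stable away from `S` and having at least two primes of multiplicative reduction, we have
`∏_{p ∣ N_E^*} v_p(Δ_E) < N_E^{11/2+ε}` where `N_E^*` is the product of all the primes of
multiplicative reduction of `E`." Its printed proof is two lines from Theorem 16.1
(`∏_{p ∣ D} v_p(Δ_E) < N^{11/3+ε}` for every admissible factorisation `N = DM`, applied to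
`D = N_E^*` or to the `D = N_E^*/p_i`), and Theorem 16.1 is the heart of the paper (Shimura-curve
parametrisations `X_0^D(M) → A_{D,M}`, Jacquet–Langlands, the refined Ribet–Takahashi formula of
§6, the Arakelov lower bound Thm 14.1 for integral quaternionic forms, the Manin-constant bound,
modularity). None of that vocabulary exists in Mathlib or in `Literature/` yet, so the corollary
itself is not proved here.

The tree vendors this corollary three times, as unproved named facts over two vocabularies:

* `Literature.NumberTheory.EllipticCurves.pasten_cor_16_2` (`PastenValuationProduct.lean`) — the
  GEOMETRIC rendering: semistability / multiplicative reduction at a finite place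
  `v : HeightOneSpectrum ℤ` literally (`W.IsSemistableAt v`, `W.HasMultiplicativeReductionAt v`),
  `v_p(Δ_E) = W.ordMinimalDiscriminant v`, the product as a `finprod` over the multiplicative
  places, and "all but finitely many `E`" as "`N_E ≥ N₀(S, ε)`";
* `Literature.NumberTheory.DiophantineGeometry.pastenShimura2024_cor_16_2`
  (`ValuationProductElliptic.lean`) and
  `Literature.NumberTheory.DiophantineGeometry.pasten_valuationProduct_awayFrom`
  (`PastenValuationProducts.lean`) — the CONDUCTOR-EXPONENT rendering: semistable at `p` iff
  `p² ∤ N_E`, multiplicative at `p` iff `p ∥ N_E`,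
  `v_p(Δ_E) = (W.minimalDiscriminantNorm ℤ).factorization p`, the product as a `Finset.prod` over
  `{p ∣ N_E : p² ∤ N_E}`, and the finitely many exceptions absorbed into a constant `K_{S,ε}`.

The two conductor-exponent renderings are the same statement
(`Literature.NumberTheory.DiophantineGeometry.pasten_valuationProduct_awayFrom_iff_pastenShimura2024_cor_16_2`,
in `DiophantineGeometry/PastenValuationProductsProofs.lean`, which also identifies the three
vendorings of Thm 1.12 = Thm 16.5). This file proves, sorry-free and from DISCHARGED dictionary
facts only, that they imply the geometric one:

* `pasten_cor_16_2_of_pastenShimura2024_cor_16_2 : pastenShimura2024_cor_16_2 → pasten_cor_16_2`;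
* `pasten_cor_16_2_of_pasten_valuationProduct_awayFrom`.

So `pasten_cor_16_2` carries no mathematical debt of its own: whoever discharges
`pastenShimura2024_cor_16_2` discharges it (one `exact`). The dictionary (all `_holds` theorems of
the tree): `WeierstrassCurve.conductorExponent_eq_one_iff_holds` (`f_v = 1 ↔` multiplicative,
Silverman ATAEC IV.10.2(b)), `WeierstrassCurve.conductorExponent_eq_zero_iff_holds` (`f_v = 0 ↔`
good, IV.10.2(a)), `WeierstrassCurve.factorization_conductorNorm_holds` (`N_E = ∏ p^{f_p}`, AEC
C.16), `WeierstrassCurve.factorization_minimalDiscriminantNorm_holds`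
(`|Δ_min| = ∏ p^{ord_p Δ_min}`, AEC VIII.8), `WeierstrassCurve.conductorNorm_pos_holds`, and
Mathlib's `Rat.HeightOneSpectrum.primesEquiv` (finite places of `ℤ` ↔ rational primes). The
passage from the constant `K` to the threshold `N₀` is: apply the `K`-form with `ε/2` and take
`N₀ ≥ K^{2/ε}`, so that `K · N^{11/2+ε/2} ≤ N^{ε/2} · N^{11/2+ε/2} = N^{11/2+ε}` for `N ≥ N₀`.

## References

* [PastenShimura2024] H. Pasten, *Shimura curves and the abc conjecture*, J. Number Theory 254
  (2024) 214–335, doi:10.1016/j.jnt.2023.07.002, arXiv:1705.09251 — Corollary 16.2 (arXiv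
  numbering, p. 49) and Theorem 16.1.
* [Silverman1994] J. H. Silverman, *Advanced Topics in the Arithmetic of Elliptic Curves*, GTM 151,
  §IV.10, Thm 10.2 (the dictionary `f_v = 0, 1, ≥ 2` ↔ good / multiplicative / additive).
-/

noncomputable section

open IsDedekindDomain Rat.HeightOneSpectrum

namespace Literature.NumberTheory.EllipticCurves

open Literature.NumberTheory.DiophantineGeometry

/-! ### The dictionary between places of `ℤ` and conductor exponents -/

section Dictionary

variable (W : WeierstrassCurve ℚ) [W.IsElliptic] (v : HeightOneSpectrum ℤ)

/-- `natGenerator : HeightOneSpectrum ℤ → ℕ` is injective (it is the first component of Mathlib's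
`Rat.HeightOneSpectrum.primesEquiv`). [folklore] -/
theorem pasten_cor_16_2.natGenerator_injective :
    Function.Injective (natGenerator (R := ℤ)) :=
  fun _ _ h ↦ primesEquiv.injective (Subtype.ext h)

/-- Every rational prime is `natGenerator v` for some finite place `v` of `ℤ`
(`Rat.HeightOneSpectrum.primesEquiv` is onto `Nat.Primes`). [folklore] -/
theorem pasten_cor_16_2.exists_natGenerator_eq {p : ℕ} (hp : p.Prime) :
    ∃ v : HeightOneSpectrum ℤ, natGenerator v = p :=
  ⟨(primesEquiv (R := ℤ)).symm ⟨p, hp⟩,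
    congrArg Subtype.val ((primesEquiv (R := ℤ)).apply_symm_apply ⟨p, hp⟩)⟩

/-- `N_E ≠ 0` (`N_E` is a positive integer, `WeierstrassCurve.conductorNorm_pos_holds`).
[folklore] -/
theorem pasten_cor_16_2.conductorNorm_ne_zero : W.conductorNorm ℤ ≠ 0 :=
  (W.conductorNorm_pos_holds).ne'

/-- **Multiplicative reduction read off the conductor.** For an elliptic `W / ℚ` and a finite
place `v` of `ℤ` with prime `p = p_v`: `W` has multiplicative reduction at `v` iff `p ∣ N_E` and
`p² ∤ N_E` (i.e. `f_p = 1`, Silverman ATAEC IV.10.2(b), via the discharged facts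
`conductorExponent_eq_one_iff_holds` and `factorization_conductorNorm_holds`).
[cite: Silverman1994, IV.10.2(b)] -/
theorem pasten_cor_16_2.hasMultiplicativeReductionAt_iff :
    W.HasMultiplicativeReductionAt v ↔
      natGenerator v ∈ (W.conductorNorm ℤ).primeFactors ∧
        ¬ natGenerator v ^ 2 ∣ W.conductorNorm ℤ := by
  have hN := pasten_cor_16_2.conductorNorm_ne_zero W
  have hp : (natGenerator v).Prime := prime_natGenerator v
  rw [← WeierstrassCurve.conductorExponent_eq_one_iff_holds v W,
    ← WeierstrassCurve.factorization_conductorNorm_holds W v, Nat.mem_primeFactors,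
    hp.pow_dvd_iff_le_factorization hN, hp.dvd_iff_one_le_factorization hN]
  simp only [hp, ne_eq, hN, not_false_eq_true, and_true, true_and]
  omega

/-- **Semistability read off the conductor.** If `W / ℚ` is semistable at `v` (good or
multiplicative reduction) then `p_v² ∤ N_E` (`f_v ≤ 1`, Silverman ATAEC IV.10.2(a),(b)).
[cite: Silverman1994, IV.10.2(a),(b)] -/
theorem pasten_cor_16_2.not_sq_dvd_of_isSemistableAt (h : W.IsSemistableAt v) :
    ¬ natGenerator v ^ 2 ∣ W.conductorNorm ℤ := by
  have hN := pasten_cor_16_2.conductorNorm_ne_zero W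
  have hp : (natGenerator v).Prime := prime_natGenerator v
  rw [hp.pow_dvd_iff_le_factorization hN, WeierstrassCurve.factorization_conductorNorm_holds W v]
  have h1 : W.conductorExponent v ≤ 1 := by
    rcases h with hg | hm
    · exact ((WeierstrassCurve.conductorExponent_eq_zero_iff_holds v W).mpr hg).le.trans
        zero_le_one
    · exact ((WeierstrassCurve.conductorExponent_eq_one_iff_holds v W).mpr hm).le
  omega

omit v in
/-- The set of places of multiplicative reduction is the preimage under `v ↦ p_v` of the finite
set `{p ∣ N_E : p² ∤ N_E}` of primes dividing the conductor exactly once. [folklore] -/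
theorem pasten_cor_16_2.setOf_hasMultiplicativeReductionAt_eq :
    {v : HeightOneSpectrum ℤ | W.HasMultiplicativeReductionAt v} =
      natGenerator ⁻¹'
        ↑((W.conductorNorm ℤ).primeFactors.filter fun p ↦ ¬ p ^ 2 ∣ W.conductorNorm ℤ) := by
  ext v
  rw [Set.mem_setOf_eq, Set.mem_preimage, Finset.mem_coe, Finset.mem_filter]
  exact pasten_cor_16_2.hasMultiplicativeReductionAt_iff W v

omit v in
/-- The set of places of multiplicative reduction of an elliptic `W / ℚ` is finite. [folklore] -/
theorem pasten_cor_16_2.finite_setOf_hasMultiplicativeReductionAt :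
    {v : HeightOneSpectrum ℤ | W.HasMultiplicativeReductionAt v}.Finite := by
  rw [pasten_cor_16_2.setOf_hasMultiplicativeReductionAt_eq W]
  exact (Finset.finite_toSet _).preimage pasten_cor_16_2.natGenerator_injective.injOn

omit v in
/-- **The two renderings of `∏_{p ∣ N_E^*} v_p(Δ_E)` agree**: the `finprod` of `ord_v (Δ_min)`
over the places of multiplicative reduction equals the `Finset.prod` of the exponents of `|Δ_min|`
over the primes dividing `N_E` exactly once
(`Literature.NumberTheory.DiophantineGeometry.multiplicativeValuationProduct`). Uses
`factorization_minimalDiscriminantNorm_holds` (`ord_v (Δ_min)` is the exponent of `p_v` in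
`|Δ_min|`, AEC VIII.8) and the bijection `primesEquiv`. [folklore] -/
theorem pasten_cor_16_2.finprod_eq_multiplicativeValuationProduct :
    ∏ᶠ v ∈ {v : HeightOneSpectrum ℤ | W.HasMultiplicativeReductionAt v},
        W.ordMinimalDiscriminant v = multiplicativeValuationProduct W := by
  classical
  have hinj : Set.InjOn (natGenerator (R := ℤ)) (natGenerator ⁻¹'
      ↑((W.conductorNorm ℤ).primeFactors.filter fun p ↦ ¬ p ^ 2 ∣ W.conductorNorm ℤ)) :=
    pasten_cor_16_2.natGenerator_injective.injOn
  rw [pasten_cor_16_2.setOf_hasMultiplicativeReductionAt_eq W, ← Finset.coe_preimage _ hinj,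
    finprod_mem_coe_finset, multiplicativeValuationProduct_def]
  have hord : ∀ u : HeightOneSpectrum ℤ, W.ordMinimalDiscriminant u =
      (W.minimalDiscriminantNorm ℤ).factorization (natGenerator u) :=
    fun u ↦ (WeierstrassCurve.factorization_minimalDiscriminantNorm_holds W u).symm
  simp_rw [hord]
  refine Finset.prod_preimage natGenerator _ hinj
    (fun p ↦ (W.minimalDiscriminantNorm ℤ).factorization p) ?_
  intro p hp hrange
  exact absurd (Set.mem_range.mpr (pasten_cor_16_2.exists_natGenerator_eq
    (Nat.prime_of_mem_primeFactors (Finset.mem_filter.mp hp).1))) hrange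

omit v in
/-- Two distinct places of multiplicative reduction give two distinct primes dividing `N_E`
exactly once. [folklore] -/
theorem pasten_cor_16_2.two_le_card {v w : HeightOneSpectrum ℤ} (hvw : v ≠ w)
    (hv : W.HasMultiplicativeReductionAt v) (hw : W.HasMultiplicativeReductionAt w) :
    2 ≤ ((W.conductorNorm ℤ).primeFactors.filter fun p ↦ ¬ p ^ 2 ∣ W.conductorNorm ℤ).card := by
  classical
  have hv' := (pasten_cor_16_2.hasMultiplicativeReductionAt_iff W v).mp hv
  have hw' := (pasten_cor_16_2.hasMultiplicativeReductionAt_iff W w).mp hw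
  have hne : natGenerator v ≠ natGenerator w :=
    fun h ↦ hvw (pasten_cor_16_2.natGenerator_injective h)
  calc 2 = ({natGenerator v, natGenerator w} : Finset ℕ).card := (Finset.card_pair hne).symm
    _ ≤ _ := Finset.card_le_card <| by
      intro p hp
      simp only [Finset.mem_insert, Finset.mem_singleton] at hp
      rcases hp with rfl | rfl
      · exact Finset.mem_filter.mpr hv'
      · exact Finset.mem_filter.mpr hw'

end Dictionary

/-! ### The reductions -/

/-- **[PastenShimura2024, Cor 16.2]: the conductor-exponent rendering implies the geometric
rendering.** From `pastenShimura2024_cor_16_2` (constant form `K_{S,ε}`, reduction types read off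
`N_E`) to `pasten_cor_16_2` (threshold form `N_E ≥ N₀(S,ε)`, reduction types at places of `ℤ`,
`finprod` of `ord_v (Δ_min)`): semistable at `v ∉ S` gives `p_v² ∤ N_E`; two distinct
multiplicative places give two primes `p ∥ N_E`; the two products agree
(`pasten_cor_16_2.finprod_eq_multiplicativeValuationProduct`); and with the `K`-form at `ε/2`
and `N₀ ≥ K^{2/ε}` one has `K · N^{11/2+ε/2} ≤ N^{11/2+ε}` for `N ≥ N₀`.
[cite: PastenShimura2024, Corollary 16.2 (arXiv numbering)] -/
theorem pasten_cor_16_2_of_pastenShimura2024_cor_16_2 (h : pastenShimura2024_cor_16_2) :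
    pasten_cor_16_2 := by
  intro S ε hε
  obtain ⟨K, hK0, hK⟩ := h S (ε / 2) (half_pos hε)
  obtain ⟨N₀, hN₀⟩ := exists_nat_ge (K ^ (2 / ε))
  refine ⟨N₀, ?_⟩
  intro W _ hS hmult hN
  obtain ⟨v, w, hvw, hv, hw⟩ := hmult
  have hNpos : (0 : ℝ) < (W.conductorNorm ℤ : ℝ) :=
    Nat.cast_pos.mpr (Nat.pos_of_ne_zero (pasten_cor_16_2.conductorNorm_ne_zero W))
  have hS' : ∀ p : ℕ, p.Prime → p ∉ S → ¬ p ^ 2 ∣ W.conductorNorm ℤ := by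
    intro p hp hpS
    obtain ⟨u, rfl⟩ := pasten_cor_16_2.exists_natGenerator_eq hp
    exact pasten_cor_16_2.not_sq_dvd_of_isSemistableAt W u (hS u hpS)
  have key := hK W hS' (pasten_cor_16_2.two_le_card W hvw hv hw)
  rw [← pasten_cor_16_2.finprod_eq_multiplicativeValuationProduct W] at key
  have hKle : K ≤ (W.conductorNorm ℤ : ℝ) ^ (ε / 2) := by
    have h1 : K = (K ^ (2 / ε)) ^ (ε / 2) := by
      rw [← Real.rpow_mul hK0.le]
      have h2 : 2 / ε * (ε / 2) = 1 := by field_simp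
      rw [h2, Real.rpow_one]
    rw [h1]
    exact Real.rpow_le_rpow (by positivity) (hN₀.trans (by exact_mod_cast hN)) (by positivity)
  calc ((∏ᶠ v ∈ {v : HeightOneSpectrum ℤ | W.HasMultiplicativeReductionAt v},
          W.ordMinimalDiscriminant v : ℕ) : ℝ)
        < K * (W.conductorNorm ℤ : ℝ) ^ (11 / 2 + ε / 2 : ℝ) := key
    _ ≤ (W.conductorNorm ℤ : ℝ) ^ (ε / 2) * (W.conductorNorm ℤ : ℝ) ^ (11 / 2 + ε / 2 : ℝ) := by
        gcongr
    _ = (W.conductorNorm ℤ : ℝ) ^ (11 / 2 + ε : ℝ) := by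
        rw [← Real.rpow_add hNpos]
        congr 1
        ring

/-- The same reduction from the other conductor-exponent copy
`Literature.NumberTheory.DiophantineGeometry.pasten_valuationProduct_awayFrom` (the same statement
as `pastenShimura2024_cor_16_2` up to unfolding `multiplicativeValuationProduct`; cf.
`Literature.NumberTheory.DiophantineGeometry.pasten_valuationProduct_awayFrom_iff_pastenShimura2024_cor_16_2`).
[cite: PastenShimura2024, Corollary 16.2 (arXiv numbering)] -/
theorem pasten_cor_16_2_of_pasten_valuationProduct_awayFrom (h : pasten_valuationProduct_awayFrom) :
    pasten_cor_16_2 :=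
  -- `pasten_valuationProduct_awayFrom` and `pastenShimura2024_cor_16_2` are definitionally the
  -- same statement (`multiplicativeValuationProduct` unfolds to the filtered product; the tree's
  -- `pasten_valuationProduct_awayFrom_iff_pastenShimura2024_cor_16_2` records the `Iff`).
  pasten_cor_16_2_of_pastenShimura2024_cor_16_2 h

end Literature.NumberTheory.EllipticCurves

end
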